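import Summits.QuantumFields.BalabanUV.Beta.FP.TowerFAnchorParities

/-!
# `BalabanUV.Beta.FP.TowerFAnchorParitiesW` — road «FP», binder row D1, ROUTE T, the (H5-F) option (3a) (road A-4, journal [D1P3-G62-A4]; an2 g85 W-3 (a), W-5 (3)):
# **THE END's STOREY-1 (ANCHOR) PARITY LETTERS `hVFm hVFt hWFm hWFt` AT `n := 0` FOR ANY STEP WEIGHT** — road g58 `TowerFAnchorParities` §2–§4 with `wStep Lc 1 ↦ w 0`
# (generator ×14, names `… ↦ …_w`, `w : ℕ → EKer 4` a family read at `0` so that the skeleton's token is the same as at the higher storeys; §1's fibre-block letters of the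
# literal's level-0 pair `VG0_inr_inr ∕ VG0_inl_inr_transpose ∕ WG0_inr_inr ∕ dressV_apply_inr_inr_G0 ∕ dressV_inl_inr_transpose_G0 ∕ dressW_apply_inr_inr_G0` were ALREADY weight-generic, imported BY NAME)

WHY (journal an2 g85 W-3 (a) ∕ W-5 (3)).  Under (3a) the END's storey-1 F-pair is the literal's level-0 pair dressed by `w 0 := fun c μ p => (α 0)⁻¹ * wF Lc Q ℓ sn 0 c μ p`
(an2 PART 96∕97; road `TowerFAnchorRowW` p753568 for the anchor row itself); v10's four parity binders at `n := 0` are discharged by g58's `hVFm_zero ∕ hVFt_zero ∕ hWFm_zero ∕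
hWFt_zero` — AT `wStep Lc 1`.  THIS FILE repeats them token for token at a generic weight (no property of `w` used).

WHAT ([folklore] BY NAME; no `def`, no `def … : Prop`, nothing cited, 0 sorry): §1 `FZero_inr_inr_w`, `FZero_inl_inr_eq_transpose_w`, `FZeroW_inr_inr_w`; §2 **`hVFm_zero_w`**, **`hVFt_zero_w`**;
§3 **`hWFm_zero_w`**, **`hWFt_zero_w`**.
WHAT THIS IS NOT: not the weight (PART 96); nothing of Bałaban's asserted, valued or discharged; 0 estimates; 0∕4 row-D1 binders (hW, hR, D1Tel, D1Rep); NOT (C1), NOT (T-ID), NOT D1,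
NEVER «G-an2-4 closed», NOT BetaPertH, NOT continuum, NOT Clay.

HONEST DEPENDENCY (page 1, mandatory): continuum YM on T⁴ ⇐ BetaPertH ∧ nine spine estimates (0/9 proved); BetaPertH ⇐ (D1) ∧ (D4) ∧ CAP+tail;
G-an2-4 gates asym, D1 and NE2/3/4.  HONEST FRAMING (cell contract, verbatim): «discharging `BetaPertH` makes Bałaban's UV stability UNCONDITIONAL —
a real constructive-QFT result; it is NOT the continuum limit and NOT the Clay problem.»  ABSOLUTE RULE (cell charter, verbatim): «No internally-minted
statement may enter as a cited fact. Every hypothesis is either kernel-proved in this package or a verbatim quotation of a PUBLISHED theorem with page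
reference. The manuscript(s) under audit are NOT citable for their own disputed steps — they are the thing under adjudication; programme-internal
(2001/route/tribunal) claims are never citable.»  Road «FP» OWNER, b2b-balaban-beta-d1-p3 gen 62, 2026-08-30.  No existing file touched.
-/

noncomputable section

open scoped BigOperators

namespace Summit.QuantumFields.BalabanUV.Beta.FP.TowerFAnchorParitiesW

open Literature.MathematicalPhysics.QuantumFieldTheory.Balaban1983to89
open Literature.MathematicalPhysics.QuantumFieldTheory.Balaban1983to89.Beta
open B4TorusKernel.MultiPeriod (translate)
open B6Lemma24Torus (pbox)
open ExpKernelCalculus (Site MKer)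
open DressedMomentNormalisation (EKer)
open HessKerRate (scaleK scaleK_apply)
open HessianTelescopingKKT (wStep)
open OneStepResolventKernel (Fib)
open OneStepKernelFamily (vertexOfK)
open StepJetData (wilsonA)
open WilsonBiStencil (wilsonW₂ wilsonW₂_inr_inr)
open BalabanStepW2 (M2Of)
open SecondOrderResponse (W2SymOfK)
open Summit.QuantumFields.BalabanUV.Beta.TameKernelCalculus (trK)
open Summit.QuantumFields.BalabanUV.Beta.BorderedHessian (sgnK)
open Summit.QuantumFields.BalabanUV.Beta.BubbleParity (vertexOfK_apply_eq_zero)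
open Summit.QuantumFields.BalabanUV.Beta.CombHId1Letters (vertexOfK_apply)
open Summit.QuantumFields.BalabanUV.Beta.SpineRooted (SpureRecOf SpureRecOf_zero_level WrecOf T2RecOf T2RecOf_zero_level WrecOf_eq M1Of M1Of_apply)
open Summit.QuantumFields.BalabanUV.Beta.ChartStepJets (WchartOf WchartOf_eq WchartOf_GcombSh)
open Summit.QuantumFields.BalabanUV.Beta.SymAveragingHessianCounts (symHessFFAt symHessFFAt_inr)
open Summit.QuantumFields.BalabanUV.Beta.SymSecondOrderTablesAn1 (symTablesAn1S2 symTablesAn1S2_M symTablesAn1S2_vh₂S symTablesAn1S2_mixFF symVh₂SAn1_inr_inr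
  symTablesAn1S2_mixFF_inr)
open Summit.QuantumFields.BalabanUV.Beta.CombChartStepJets (GcombSh JsB12CombSh0 JsB12CombSh0_eq JsComb0Of_W)
open Summit.QuantumFields.BalabanUV.Beta.D1BFx.LiteralStencilSockets (JsB12CombSh0_S_an1_inr_inr JsB12CombSh0_S_an1_inl_inr symTablesAn1S2_V_inr_inr)
open Summit.QuantumFields.BalabanUV.Beta.NVertexParitiesW (W2SymOfK_apply_eq_zero)
open Summit.QuantumFields.BalabanUV.Beta.GAN24.SecondOrderReadersParity (parityEven_evenHalf)
open Summit.QuantumFields.BalabanUV.Beta.FP.KernelPeriodisationFib (Idx perF perZ perF_apply perZ_apply)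
open Summit.QuantumFields.BalabanUV.Beta.FP.KernelPeriodisationFibLoc (dper dper_apply)
open Summit.QuantumFields.BalabanUV.Beta.FP.PeriodisedBorderTables (perZ_dper_symm)
open Summit.QuantumFields.BalabanUV.Beta.FP.KernelStepDressing (dressV dressW dressV_apply dressW_apply)
open Summit.QuantumFields.BalabanUV.Beta.FP.WoundEvenFamilyParities (parityEven_tsum inr_inr_tsum_eq_zero inr_inr_evenHalf_eq_zero
  perF_dper_apply_eq_zero_of_inr_inr perF_dper_antitwin_fμ_of_parityEven)
open Summit.QuantumFields.BalabanUV.Beta.FP.TowerFAnchorParities (VG0_inr_inr VG0_inl_inr_transpose WG0_inr_inr dressV_apply_inr_inr_G0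
  dressV_inl_inr_transpose_G0 dressW_apply_inr_inr_G0)

variable {Lc : ℕ} [NeZero Lc] (hLc : Odd Lc) (N : ℕ) (cΛ cB : ℝ)

/-! ## §1 The END's storey-1 families at a generic weight `w 0`: `scaleK σ′₀ σ′₀ (Lc⁴ • dressV …)` ∕ `scaleK σ′₀ σ′₀ (Lc⁸ • dressW …)` -/

section Family

variable (uF : ℕ → ℝ) (w : ℕ → EKer (3 + 1))

/-- [folklore] the END's storey-1 first-order family has no multiplier–multiplier entries. -/
theorem FZero_inr_inr_w (μ : Fin (3 + 1)) (y x z : Site (3 + 1)) (m m' : Fin (3 + 1)) :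
  scaleK (Sum.elim (fun _ : Fin (3 + 1) => (1 : ℝ)) (fun _ : Fin (3 + 1) => (uF 0))) (Sum.elim (fun _ : Fin (3 + 1) => (1 : ℝ)) (fun _ : Fin (3 + 1) => (uF 0)))
    ((Lc : ℝ) ^ 4 • dressV Lc Lc (w 0) (vertexOfK (GcombSh (d := 3) Lc 0) Lc (JsB12CombSh0 hLc N (symTablesAn1S2 3 Lc cΛ) cΛ cB 0).S) μ y) x z (Sum.inr m) (Sum.inr m') = 0 := by
  rw [scaleK_apply]
  simp only [Pi.smul_apply, smul_eq_mul, dressV_apply_inr_inr_G0, mul_zero, zero_mul]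

/-- [folklore] the END's storey-1 first-order family reads `(inl α, inr m)` at `(x, z)` as `(inr m, inl α)` at `(z, x)` (equal units on both legs). -/
theorem FZero_inl_inr_eq_transpose_w (μ : Fin (3 + 1)) (y x z : Site (3 + 1)) (α m : Fin (3 + 1)) :
  scaleK (Sum.elim (fun _ : Fin (3 + 1) => (1 : ℝ)) (fun _ : Fin (3 + 1) => (uF 0))) (Sum.elim (fun _ : Fin (3 + 1) => (1 : ℝ)) (fun _ : Fin (3 + 1) => (uF 0)))
    ((Lc : ℝ) ^ 4 • dressV Lc Lc (w 0) (vertexOfK (GcombSh (d := 3) Lc 0) Lc (JsB12CombSh0 hLc N (symTablesAn1S2 3 Lc cΛ) cΛ cB 0).S) μ y) x z (Sum.inl α) (Sum.inr m)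
   = scaleK (Sum.elim (fun _ : Fin (3 + 1) => (1 : ℝ)) (fun _ : Fin (3 + 1) => (uF 0))) (Sum.elim (fun _ : Fin (3 + 1) => (1 : ℝ)) (fun _ : Fin (3 + 1) => (uF 0)))
    ((Lc : ℝ) ^ 4 • dressV Lc Lc (w 0) (vertexOfK (GcombSh (d := 3) Lc 0) Lc (JsB12CombSh0 hLc N (symTablesAn1S2 3 Lc cΛ) cΛ cB 0).S) μ y) z x (Sum.inr m) (Sum.inl α) := by
  rw [scaleK_apply, scaleK_apply]
  simp only [Pi.smul_apply, smul_eq_mul, Sum.elim_inl, Sum.elim_inr, dressV_inl_inr_transpose_G0]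
  ring

/-- [folklore] the END's storey-1 second-order family has no `μμ` block. -/
theorem FZeroW_inr_inr_w (μ : Fin (3 + 1)) (y : Site (3 + 1)) (ν : Fin (3 + 1)) (y' x z : Site (3 + 1)) (m m' : Fin (3 + 1)) :
  scaleK (Sum.elim (fun _ : Fin (3 + 1) => (1 : ℝ)) (fun _ : Fin (3 + 1) => (uF 0))) (Sum.elim (fun _ : Fin (3 + 1) => (1 : ℝ)) (fun _ : Fin (3 + 1) => (uF 0)))
    ((Lc : ℝ) ^ 8 • dressW Lc Lc (w 0) (JsB12CombSh0 hLc N (symTablesAn1S2 3 Lc cΛ) cΛ cB 0).W μ y ν y') x z (Sum.inr m) (Sum.inr m') = 0 := by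
  rw [scaleK_apply]
  simp only [Pi.smul_apply, smul_eq_mul, dressW_apply_inr_inr_G0, mul_zero, zero_mul]

end Family

/-! ## §2 `hVFm hVFt` AT STOREY 1 (generic weight), in v10's binder texts at `n := 0` under σ₀ = {`(𝒱F 1)` ↦ the dressed literal family}, torus and index map generic -/

section RecordV

variable (Lc) (uF : ℕ → ℝ) (w : ℕ → EKer (3 + 1))

/-- [folklore] **`hVFm` AT STOREY 1** — v10 `StepRecursionFeedNestedNamedI.d1Tel_JcComp_ctr_namedI`'s binder `hVFm` (L.246) AT `n := 0` with `(𝒱F 1)` ↦ the σ′₀-scaled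
`Lc⁴ •` dressed literal first-order family and the index map generic (landing in multiplier fibres): the periodised family VANISHES on two such indices. -/
theorem hVFm_zero_w {M : Fin (3 + 1) → ℕ} [∀ i, NeZero (M i)] {ι : Type*} (f : ι → Idx M (Fib 3)) (hf : ∀ a : ι, ∃ m : Fin (3 + 1), (f a).2 = Sum.inr m)
   (μ : Fin (3 + 1)) (y : Fin (3 + 1) → ℤ) (a a' : ι) :
  (perF M (dper M ((fun μ y => scaleK (Sum.elim (fun _ : Fin (3 + 1) => (1 : ℝ)) (fun _ : Fin (3 + 1) => (uF 0))) (Sum.elim (fun _ : Fin (3 + 1) => (1 : ℝ)) (fun _ : Fin (3 + 1) => (uF 0))) ((Lc : ℝ) ^ 4 • dressV Lc Lc (w 0) (vertexOfK (GcombSh (d := 3) Lc 0) Lc (JsB12CombSh0 hLc N (symTablesAn1S2 3 Lc cΛ) cΛ cB 0).S) μ y)) μ y))) (f a) (f a') = 0 := by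
  obtain ⟨m, hm⟩ := hf a
  obtain ⟨m', hm'⟩ := hf a'
  have ha : f a = ((f a).1, Sum.inr m) := Prod.ext rfl hm
  have ha' : f a' = ((f a').1, Sum.inr m') := Prod.ext rfl hm'
  rw [ha, ha', perF_apply]
  simp only [perZ_apply, dper_apply, FZero_inr_inr_w, tsum_zero]

/-- [folklore] **`hVFt` AT STOREY 1** — v10's binder `hVFt` (L.247) AT `n := 0` under the same σ₀: a field index against an index in a multiplier fibre reads the same
both ways (road `PeriodisedBorderTables.perZ_dper_symm` on the block-symmetrised kernel, as in `TowerFFamilyParities.hVFt_rec`). -/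
theorem hVFt_zero_w {M : Fin (3 + 1) → ℕ} [∀ i, NeZero (M i)] {ι : Type*} (f : ι → Idx M (Fib 3)) (hf : ∀ a : ι, ∃ m : Fin (3 + 1), (f a).2 = Sum.inr m)
   (μ : Fin (3 + 1)) (y : Fin (3 + 1) → ℤ) (b : ↥(pbox M) × Fin (3 + 1)) (a : ι) :
  (perF M (dper M ((fun μ y => scaleK (Sum.elim (fun _ : Fin (3 + 1) => (1 : ℝ)) (fun _ : Fin (3 + 1) => (uF 0))) (Sum.elim (fun _ : Fin (3 + 1) => (1 : ℝ)) (fun _ : Fin (3 + 1) => (uF 0))) ((Lc : ℝ) ^ 4 • dressV Lc Lc (w 0) (vertexOfK (GcombSh (d := 3) Lc 0) Lc (JsB12CombSh0 hLc N (symTablesAn1S2 3 Lc cΛ) cΛ cB 0).S) μ y)) μ y))) (b.1, Sum.inl b.2) (f a)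
   = (perF M (dper M ((fun μ y => scaleK (Sum.elim (fun _ : Fin (3 + 1) => (1 : ℝ)) (fun _ : Fin (3 + 1) => (uF 0))) (Sum.elim (fun _ : Fin (3 + 1) => (1 : ℝ)) (fun _ : Fin (3 + 1) => (uF 0))) ((Lc : ℝ) ^ 4 • dressV Lc Lc (w 0) (vertexOfK (GcombSh (d := 3) Lc 0) Lc (JsB12CombSh0 hLc N (symTablesAn1S2 3 Lc cΛ) cΛ cB 0).S) μ y)) μ y))) (f a) (b.1, Sum.inl b.2) := by
  obtain ⟨m, hm⟩ := hf a
  have ha : f a = ((f a).1, Sum.inr m) := Prod.ext rfl hm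
  have hsym : ∀ (x z : Site (3 + 1)) (α' m' : Fin (3 + 1)),
      scaleK (Sum.elim (fun _ : Fin (3 + 1) => (1 : ℝ)) (fun _ : Fin (3 + 1) => (uF 0))) (Sum.elim (fun _ : Fin (3 + 1) => (1 : ℝ)) (fun _ : Fin (3 + 1) => (uF 0)))
          ((Lc : ℝ) ^ 4 • dressV Lc Lc (w 0) (vertexOfK (GcombSh (d := 3) Lc 0) Lc (JsB12CombSh0 hLc N (symTablesAn1S2 3 Lc cΛ) cΛ cB 0).S) μ y) x z (Sum.inl α') (Sum.inr m')
        = scaleK (Sum.elim (fun _ : Fin (3 + 1) => (1 : ℝ)) (fun _ : Fin (3 + 1) => (uF 0))) (Sum.elim (fun _ : Fin (3 + 1) => (1 : ℝ)) (fun _ : Fin (3 + 1) => (uF 0)))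
          ((Lc : ℝ) ^ 4 • dressV Lc Lc (w 0) (vertexOfK (GcombSh (d := 3) Lc 0) Lc (JsB12CombSh0 hLc N (symTablesAn1S2 3 Lc cΛ) cΛ cB 0).S) μ y) z x (Sum.inr m') (Sum.inl α') :=
    fun x z α' m' => FZero_inl_inr_eq_transpose_w hLc N cΛ cB uF w μ y x z α' m'
  rw [ha, perF_apply, perF_apply]
  beta_reduce
  generalize scaleK (Sum.elim (fun _ : Fin (3 + 1) => (1 : ℝ)) (fun _ : Fin (3 + 1) => (uF 0))) (Sum.elim (fun _ : Fin (3 + 1) => (1 : ℝ)) (fun _ : Fin (3 + 1) => (uF 0)))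
      ((Lc : ℝ) ^ 4 • dressV Lc Lc (w 0) (vertexOfK (GcombSh (d := 3) Lc 0) Lc (JsB12CombSh0 hLc N (symTablesAn1S2 3 Lc cΛ) cΛ cB 0).S) μ y) = K at hsym ⊢
  let S : MKer (3 + 1) (Fib 3) := fun x z a' b' =>
    match a', b' with
    | Sum.inl α', Sum.inr m₁ => K x z (Sum.inl α') (Sum.inr m₁)
    | Sum.inr m₁, Sum.inl α' => K z x (Sum.inl α') (Sum.inr m₁)
    | _, _ => 0
  have hS : ∀ (x z : Site (3 + 1)) (a' b' : Fib 3), S x z a' b' = S z x b' a' := by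
    intro x z a' b'
    rcases a' with α' | m₁ <;> rcases b' with α'' | m₂ <;> rfl
  have e1 : perZ M (dper M K) ((b.1 : ↥(pbox M)) : Site (3 + 1)) (((f a).1 : ↥(pbox M)) : Site (3 + 1)) (Sum.inl b.2) (Sum.inr m)
      = perZ M (dper M S) ((b.1 : ↥(pbox M)) : Site (3 + 1)) (((f a).1 : ↥(pbox M)) : Site (3 + 1)) (Sum.inl b.2) (Sum.inr m) := by
    simp only [perZ_apply, dper_apply]; rfl
  have e2 : perZ M (dper M K) (((f a).1 : ↥(pbox M)) : Site (3 + 1)) ((b.1 : ↥(pbox M)) : Site (3 + 1)) (Sum.inr m) (Sum.inl b.2)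
      = perZ M (dper M S) (((f a).1 : ↥(pbox M)) : Site (3 + 1)) ((b.1 : ↥(pbox M)) : Site (3 + 1)) (Sum.inr m) (Sum.inl b.2) := by
    simp only [perZ_apply, dper_apply, ← hsym]; rfl
  rw [e1, e2]
  exact perZ_dper_symm M hS _ _ _ _

end RecordV

/-! ## §3 `hWFm hWFt` AT STOREY 1 (generic weight), at the wound even half of the dressed literal second-order family -/

section RecordW

variable (Lc) (uF : ℕ → ℝ) (w : ℕ → EKer (3 + 1)) {M : Fin (3 + 1) → ℕ} (Mb : Fin (3 + 1) → ℕ) {ι : Type*} (f : ι → Idx M (Fib 3))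
  (hf : ∀ a : ι, ∃ m : Fin (3 + 1), (f a).2 = Sum.inr m)
include hf

/-- [folklore] **`hWFm` AT STOREY 1** — v10's binder `hWFm` (L.248) AT `n := 0` with `(𝒲bF 1) B` ↦ the WOUND EVEN half of the σ′₀-scaled `Lc⁸ •` dressed literal
second-order family (box `Mb` for `Mc B`) and a generic multiplier-valued index map: on two such indices the periodised family VANISHES. -/
theorem hWFm_zero_w (μ : Fin (3 + 1)) (y : Fin (3 + 1) → ℤ) (ν : Fin (3 + 1)) (y' : Fin (3 + 1) → ℤ) (a a' : ι) :
  (perF M (dper M ((fun μ y ν y' => (fun x z a b => ∑' e : Site (3 + 1), ((1 / 2 : ℝ) • ((fun μ y ν y' => scaleK (Sum.elim (fun _ : Fin (3 + 1) => (1 : ℝ)) (fun _ : Fin (3 + 1) => (uF 0))) (Sum.elim (fun _ : Fin (3 + 1) => (1 : ℝ)) (fun _ : Fin (3 + 1) => (uF 0))) ((Lc : ℝ) ^ 8 • dressW Lc Lc (w 0) (JsB12CombSh0 hLc N (symTablesAn1S2 3 Lc cΛ) cΛ cB 0).W μ y ν y')) μ y ν (translate Mb y' e) + sgnK (trK ((fun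 μ y ν y' => scaleK (Sum.elim (fun _ : Fin (3 + 1) => (1 : ℝ)) (fun _ : Fin (3 + 1) => (uF 0))) (Sum.elim (fun _ : Fin (3 + 1) => (1 : ℝ)) (fun _ : Fin (3 + 1) => (uF 0))) ((Lc : ℝ) ^ 8 • dressW Lc Lc (w 0) (JsB12CombSh0 hLc N (symTablesAn1S2 3 Lc cΛ) cΛ cB 0).W μ y ν y')) μ y ν (translate Mb y' e))))) x z a b)) μ y ν y'))) (f a) (f a') = 0 :=
  perF_dper_apply_eq_zero_of_inr_inr M f hf
    (fun x z m m' => inr_inr_tsum_eq_zero _ (fun e x' z' m₁ m₂ => inr_inr_evenHalf_eq_zero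
      (fun x'' z'' m₃ m₄ => FZeroW_inr_inr_w hLc N cΛ cB uF w μ y ν (translate Mb y' e) x'' z'' m₃ m₄) x' z' m₁ m₂) x z m m') a a'

/-- [folklore] **`hWFt` AT STOREY 1** — v10's binder `hWFt` (L.249) AT `n := 0` under the same σ₀: the (field, multiplier) border is the ANTI-twin of the
(multiplier, field) border (graded-evenness of the wound even half: road `parityEven_tsum` over GAN24 `parityEven_evenHalf`). -/
theorem hWFt_zero_w (μ : Fin (3 + 1)) (y : Fin (3 + 1) → ℤ) (ν : Fin (3 + 1)) (y' : Fin (3 + 1) → ℤ) (b : ↥(pbox M) × Fin (3 + 1)) (a : ι) :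
  (perF M (dper M ((fun μ y ν y' => (fun x z a b => ∑' e : Site (3 + 1), ((1 / 2 : ℝ) • ((fun μ y ν y' => scaleK (Sum.elim (fun _ : Fin (3 + 1) => (1 : ℝ)) (fun _ : Fin (3 + 1) => (uF 0))) (Sum.elim (fun _ : Fin (3 + 1) => (1 : ℝ)) (fun _ : Fin (3 + 1) => (uF 0))) ((Lc : ℝ) ^ 8 • dressW Lc Lc (w 0) (JsB12CombSh0 hLc N (symTablesAn1S2 3 Lc cΛ) cΛ cB 0).W μ y ν y')) μ y ν (translate Mb y' e) + sgnK (trK ((fun μ y ν y' => scaleK (Sum.elim (fun _ : Fin (3 + 1) => (1 : ℝ)) (fun _ : Fin (3 + 1) => (uF 0))) (Sum.elim (fun _ : Fin (3 + 1) => (1 : ℝ)) (fun _ : Fin (3 + 1) => (uF 0))) ((Lc : ℝ) ^ 8 • dressW Lc Lc (w 0) (JsB12CombSh0 hLc N (symTablesAn1S2 3 Lc cΛ) cΛ cB 0).W μ y ν y')) μ y ν (translate Mb y' e))))) x z a b)) μ y ν y'))) (b.1, Sum.inl b.2) (f a) = -((perF M (dper M ((fun μ y ν y' => (fun x z a b =>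 ∑' e : Site (3 + 1), ((1 / 2 : ℝ) • ((fun μ y ν y' => scaleK (Sum.elim (fun _ : Fin (3 + 1) => (1 : ℝ)) (fun _ : Fin (3 + 1) => (uF 0))) (Sum.elim (fun _ : Fin (3 + 1) => (1 : ℝ)) (fun _ : Fin (3 + 1) => (uF 0))) ((Lc : ℝ) ^ 8 • dressW Lc Lc (w 0) (JsB12CombSh0 hLc N (symTablesAn1S2 3 Lc cΛ) cΛ cB 0).W μ y ν y')) μ y ν (translate Mb y' e) + sgnK (trK ((fun μ y ν y' => scaleK (Sum.elim (fun _ : Fin (3 + 1) => (1 : ℝ)) (fun _ : Fin (3 + 1) => (uF 0))) (Sum.elim (fun _ : Fin (3 + 1) => (1 : ℝ)) (fun _ : Fin (3 + 1) => (uF 0))) ((Lc : ℝ) ^ 8 • dressW Lc Lc (w 0) (JsB12CombSh0 hLc N (symTablesAn1S2 3 Lc cΛ) cΛ cB 0).W μ y ν y')) μ y ν (translate Mb y' e))))) x z a b)) μ y ν y'))) (f a) (b.1, Sum.inl b.2)) :=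
  perF_dper_antitwin_fμ_of_parityEven M f hf (parityEven_tsum _ fun _ => parityEven_evenHalf _) b a

end RecordW

end Summit.QuantumFields.BalabanUV.Beta.FP.TowerFAnchorParitiesW

end
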